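import Summits.QuantumFields.YangMills.Theorems.FluctuationComparisonRegPrIntLS2BetaTubularChartActLocal
import Summits.QuantumFields.YangMills.Theorems.FluctuationComparisonRegPrIntLS2BetaTubularChartDockTransversal
import HarnessLib

/-!
# LINE g18-1 S2β LAPLACE — THE DOCKED (C3β″) CHART, LOCAL EDITION (EXPORT (F1)(F2)(F3) + the free-bond frame `eV` + (F4a) the BONDWISE FORMULA of the
# transversal + (F4b′) the density through `det jac` — the chart-side LOCALITY inputs of DET-REP's (LOC)∕(JAC) rows)

Crux `stmt-QuantumFields-20520` (`…Theses.UnitScaleTilt.FluctuationComparisonRegPrIntL`); cell `ym3-torus` (HUMAN RULING D-0037 — YM₃ on T³ is ladder rung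
R3, not the Clay problem), width seat `ym3-torus-px21` g11; count-neutral helper (`--kind proof --supports stmt-QuantumFields-20520 --as helper`).
Theorems only: 0 `def`, 0 `instance`, 0 `notation`, 0 `sorry`.

WHAT.  `exists_tubularHaarChart_pivotAct_local` = this seat's docked factorised chart ✓`…TubularChartDockFactorised.exists_tubularHaarChart_pivotAct_factorised`
(p745754) PLUS the frame `eV : ℝ^{dV} ≃L 𝔰𝔲(2)^{free bonds}` exported as a datum, (F4a) «`σ y b = U₀ b · (T(b₊)⁻¹ · Θ((eV y)_b) · T(b₊))`,
`T = combTransporter (K−J) U₀`, for every bond off comb ∪ pivots» (so `σ y b` depends on `y` only through the `b`-component of `eV y`: `Hess (A ∘ σ)` is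
plaquette-local in these coordinates) and (F4b′) «`jV y = σ₀ · |det jac_{𝔰𝔲(2)^{free}}(eV y)|`, `σ₀ > 0`» (w5-20520 g14 21:29:54Z: «(F4) is the right next export»;
block-diagonality of the product-algebra `jac` is the (JAC) hand's).  For the record, p745754 = the docked transversal chart ✓`…TubularChartDockTransversal.exists_tubularHaarChart_pivotAct_transversal`
(p741985: group chart `e` into `↥(residualSubgroup F hJK) × SU(2)^{pivots}` with `𝓝 1 ≤ map e (𝓝 0)`, smooth continuous transversal `σ` through `U₀`, (D0) `σ y = U₀`
on comb ∪ pivots, (D1) constant comb transporter, (T2) off-pivot quadratic transversality, `𝓝 (σ 0) ≤ map Θ (𝓝 0)`, injectivity, chart identity, radius `ρ`)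
with the window, the density and the openness EXPORTED IN PRODUCT FORM, token-matched to the binders of w5-20520 g14's (CT)
`…S2BetaLaplaceInstShift.laplaceLimit_of_charts_tendsto_shift`:
* (F1) `IsOpen UZ ∧ IsOpen UV ∧ 0 ∈ UZ ∧ 0 ∈ UV`, `InjOn Θ (UZ ×ˢ UV)`, `0 < ρ ∧ closedBall 0 ρ ⊆ UZ`;
* (F2) `Continuous jZ ∧ Continuous jV ∧ (∀ z, 0 ≤ jZ z) ∧ (∀ y, 0 ≤ jV y) ∧ 0 < jZ 0 ∧ 0 < jV 0 ∧ (∀ᶠ y in 𝓝 0, 0 < jV y)`, chart identity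
  `dU|_{Θ(UZ × UV)} = Θ_*((ofReal (jZ w.1 * jV w.2) · dz ⊗ dy)|_{UZ × UV})`, and `0 < ∫_{ball 0 ρ} jZ` (so `∫_{ball ρ} J(z, y₁) dz = jV y₁ · ∫_{ball ρ} jZ > 0`
  at every shifted base point `y₁` near `0`);
* (F3) `∀ p ∈ UZ ×ˢ UV, ∀ s ∈ 𝓝 p, Θ '' s ∈ 𝓝 (Θ p)` (openness at EVERY point; at `(0, y₁)` with `Θ (0, y₁) = σ y₁` it is (CT)'s `hopen₁` by `Filter.le_map`).
Proof: this seat's lattice letter ✓`…TubularChartActLocal.exists_tubularHaarChart_act_local` + the (T2) lemma ✓`offPivot_transversal_of_rows` and the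
residual-subgroup lift exactly as in p741985; the radius is shrunk so that `jZ ≥ jZ(0)∕2` on `ball 0 ρ`.
HONEST: a chart-side letter; proves no stub; (CT)∕FOUR-POINT-DECAY∕LAPLACE∕S2β∕crux 20520 NOT proved; rung R3 — NOT d = 4, NOT infinite volume, NOT a mass gap,
NOT Clay.
[cite: Balaban1985Variational, Thm 1 (8)-(10) p.279, (4) p.278, (19) p.281; Balaban1987RG1, p.256; Helgason2000, Ch. I §1 Thm 1.14 (13) p.96;
Balaban1985Averaging, (8), (10) p.18]
-/

noncomputable section

open MeasureTheory MeasureTheory.Measure Filter Topology Set Function Metric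
open scoped ENNReal Matrix.Norms.L2Operator
open Literature.MathematicalPhysics.QuantumFieldTheory.Balaban1983to89
open Literature.MathematicalPhysics.QuantumFieldTheory.Balaban1983to89.T3ContinuumYM3Torus
open Literature.MathematicalPhysics.QuantumFieldTheory.Balaban1983to89.HaarExponentialChart
open Literature.MathematicalPhysics.QuantumFieldTheory.Balaban1983to89.LogChartProduct
open Literature.MathematicalPhysics.QuantumFieldTheory.Balaban1983to89.T3UnitLawDensityEML
open Literature.MathematicalPhysics.QuantumFieldTheory.Balaban1983to89.T3TiltDescent
open Literature.MathematicalPhysics.QuantumFieldTheory.Balaban1983to89.B15DeterminingSets (embIter)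
open Literature.MathematicalPhysics.QuantumFieldTheory.Balaban1983to89.B12GaugeOrbits021 (IsResidual)
open scoped Literature.MathematicalPhysics.QuantumFieldTheory.Balaban1983to89.T3OrbitAverage
open Summit.QuantumFields.YangMills.Theorems.FluctuationComparisonRegPrIntLWregChain (iterCentralBond)
open Summit.QuantumFields.YangMills.Theorems.FluctuationComparisonRegPrIntLS2BetaResidualSubgroup
open Summit.QuantumFields.YangMills.Theorems.FluctuationComparisonRegPrIntLS2BetaResidualGaugeRooted
open Summit.QuantumFields.YangMills.Theorems.FluctuationComparisonRegPrIntLS2BetaLaplaceInstGroupChart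
open Summit.QuantumFields.YangMills.Theorems.FluctuationComparisonRegPrIntLS2BetaTubularChartActLocal
open Literature.MathematicalPhysics.QuantumFieldTheory.Balaban1983to89.B13HaarSigmaJacobian (jac)
open Summit.QuantumFields.YangMills.Theorems.FluctuationComparisonRegPrIntLS2BetaTubularChartDockTransversal (offPivot_transversal_of_rows)
open Summit.QuantumFields.YangMills.Theorems.FluctuationComparisonRegPrIntLS2BetaSignedComb (combTransporter)
open Summit.QuantumFields.YangMills.Theorems.FluctuationComparisonRegPrIntLS2BetaSignedCombKill (combSet)
open Summit.QuantumFields.YangMills.Theorems.FluctuationComparisonRegPrIntLS2BetaSignedCombLipschitz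
open Summit.QuantumFields.YangMills.Theorems.FluctuationComparisonRegPrIntLS2BetaResidualGauge (residual_one)
open Summit.QuantumFields.YangMills.Theorems.FluctuationComparisonRegPrIntLS2BetaResidualGaugeCentral (exists_central_isResidual_of_residual)

namespace Summit.QuantumFields.YangMills.Theorems.FluctuationComparisonRegPrIntLS2BetaTubularChartDockLocal

variable (F : T3Family) {J K : ℕ} (hJK : J ≤ K)

/-! ## The docked chart rows, local edition -/

set_option maxHeartbeats 400000 in
/-- ★★★ **THE (C3β″) CHART, DOCKED, LOCAL EDITION** — for `S := residualSubgroup F hJK`, `act := pivotAct F hJK (iterCentralBond (K − J))` and every base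
point `U₀`: the rows of ✓`…TubularChartDockTransversal.exists_tubularHaarChart_pivotAct_transversal` (group chart `e`, smooth continuous transversal `σ` through `U₀`,
(D0), (D1), (T2), `𝓝 (σ 0) ≤ map Θ (𝓝 0)`, injectivity, chart identity, radius `ρ`) with the window EXPORTED as a product `UZ ×ˢ UV` of open neighbourhoods of `0`
(F1), the density as a product `jZ z · jV y` of continuous nonnegative functions positive at `0` (F2, with `∀ᶠ y in 𝓝 0, 0 < jV y` and `0 < ∫_{ball 0 ρ} jZ`),
the tube map OPEN AT EVERY POINT of `UZ ×ˢ UV` (F3), the free-bond frame `eV` exported, (F4a) the bondwise formula of `σ` off comb ∪ pivots and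
(F4b′) `jV = σ₀·|det jac(eV ·)|`. [cite: Balaban1985Variational, Thm 1 (8)-(10) p.279, (19) p.281; Helgason2000, Ch. I §1 Thm 1.14 (13) p.96;
Balaban1985Averaging, (8), (10) p.18] -/
theorem exists_tubularHaarChart_pivotAct_local (hk : K - J ≤ (F.P K).m + (F.P K).K)
    [DecidablePred (· ∈ (combSet (K - J) : Set (PBond (F.P K) 0)) ∪ Set.range (iterCentralBond (P := F.P K) (K - J)))] (dZ dV : ℕ)
    (hdZ : dZ = Module.finrank ℝ (specialUnitaryLogChart (Fin 2)).lie *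
      ((Fintype.card (Site (F.P K) 0) - Fintype.card (Site (F.P K) (K - J))) + Fintype.card (PBond (F.P K) (K - J))))
    (hdV : dV = Module.finrank ℝ (specialUnitaryLogChart (Fin 2)).lie *
        (Fintype.card (PBond (F.P K) 0) - Fintype.card (PBond (F.P K) (K - J))) -
      Module.finrank ℝ (specialUnitaryLogChart (Fin 2)).lie * (Fintype.card (Site (F.P K) 0) - Fintype.card (Site (F.P K) (K - J))))
    (U₀ : GaugeField (F.P K) 0 (Matrix.specialUnitaryGroup (Fin 2) ℂ)) :
    ∃ (e : EuclideanSpace ℝ (Fin dZ) → residualSubgroup F hJK × (PBond (F.P K) (K - J) → Matrix.specialUnitaryGroup (Fin 2) ℂ))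
      (σ : EuclideanSpace ℝ (Fin dV) → GaugeField (F.P K) 0 (Matrix.specialUnitaryGroup (Fin 2) ℂ))
      (eV : EuclideanSpace ℝ (Fin dV) ≃L[ℝ] (piLogChart (specialUnitaryLogChart (Fin 2)) {b : PBond (F.P K) 0 // b ∉ (combSet (K - J) : Set (PBond (F.P K) 0)) ∪ Set.range (iterCentralBond (P := F.P K) (K - J))}).lie)
      (UZ : Set (EuclideanSpace ℝ (Fin dZ))) (UV : Set (EuclideanSpace ℝ (Fin dV)))
      (jZ : EuclideanSpace ℝ (Fin dZ) → ℝ) (jV : EuclideanSpace ℝ (Fin dV) → ℝ) (ρ : ℝ),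
      Continuous e ∧ e 0 = 1 ∧
      𝓝 (1 : residualSubgroup F hJK × (PBond (F.P K) (K - J) → Matrix.specialUnitaryGroup (Fin 2) ℂ)) ≤ map e (𝓝 0) ∧
      Continuous σ ∧ σ 0 = U₀ ∧
      ContDiff ℝ ⊤ (fun y : EuclideanSpace ℝ (Fin dV) => fun b : PBond (F.P K) 0 =>
        ((σ y b : Matrix.specialUnitaryGroup (Fin 2) ℂ) : Matrix (Fin 2) (Fin 2) ℂ)) ∧
      (∀ y, ∀ b ∈ (combSet (K - J) : Set (PBond (F.P K) 0)) ∪ Set.range (iterCentralBond (P := F.P K) (K - J)), σ y b = U₀ b) ∧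
      (∀ y, combTransporter (K - J) (σ y) = combTransporter (K - J) U₀) ∧
      (∀ y (b : PBond (F.P K) 0) (hb : b ∉ (combSet (K - J) : Set (PBond (F.P K) 0)) ∪ Set.range (iterCentralBond (P := F.P K) (K - J))),
        σ y b = U₀ b * ((combTransporter (K - J) U₀ b.tgt)⁻¹ *
          (isChartRep_specialUnitaryGroup (n := Fin 2)).expChart
            (lieApply (specialUnitaryLogChart (Fin 2)) {b : PBond (F.P K) 0 // b ∉ (combSet (K - J) : Set (PBond (F.P K) 0)) ∪ Set.range (iterCentralBond (P := F.P K) (K - J))} (eV y) ⟨b, hb⟩) *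
          combTransporter (K - J) U₀ b.tgt)) ∧
      (∃ c₁ : ℝ, 0 < c₁ ∧ ∀ᶠ y in 𝓝 (0 : EuclideanSpace ℝ (Fin dV)),
        c₁ * ‖y‖ ^ 2 ≤ ⨅ w : {w : Site (F.P K) 0 → Matrix.specialUnitaryGroup (Fin 2) ℂ |
              ∀ U : GaugeField (F.P K) 0 (Matrix.specialUnitaryGroup (Fin 2) ℂ),
                descendTo F ℰp J K hJK (GaugeField.gaugeAct w U) = descendTo F ℰp J K hJK U},
            ∑ ℓ ∈ Finset.univ.filter (fun ℓ : PBond (F.P K) 0 => ∀ c, iterCentralBond (P := F.P K) (K - J) c ≠ ℓ),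
              dist1 (σ y ℓ * ((GaugeField.gaugeAct (w : Site (F.P K) 0 → Matrix.specialUnitaryGroup (Fin 2) ℂ) U₀) ℓ)⁻¹) ^ 2) ∧
      𝓝 (σ 0) ≤ map (fun p : EuclideanSpace ℝ (Fin dZ) × EuclideanSpace ℝ (Fin dV) =>
        pivotAct F hJK (iterCentralBond (P := F.P K) (K - J)) (e p.1) (σ p.2)) (𝓝 0) ∧
      IsOpen UZ ∧ IsOpen UV ∧ (0 : EuclideanSpace ℝ (Fin dZ)) ∈ UZ ∧ (0 : EuclideanSpace ℝ (Fin dV)) ∈ UV ∧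
      InjOn (fun p : EuclideanSpace ℝ (Fin dZ) × EuclideanSpace ℝ (Fin dV) =>
        pivotAct F hJK (iterCentralBond (P := F.P K) (K - J)) (e p.1) (σ p.2)) (UZ ×ˢ UV) ∧
      (∀ p ∈ UZ ×ˢ UV, ∀ s ∈ 𝓝 p, (fun p : EuclideanSpace ℝ (Fin dZ) × EuclideanSpace ℝ (Fin dV) =>
        pivotAct F hJK (iterCentralBond (P := F.P K) (K - J)) (e p.1) (σ p.2)) '' s ∈
        𝓝 ((fun p : EuclideanSpace ℝ (Fin dZ) × EuclideanSpace ℝ (Fin dV) =>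
        pivotAct F hJK (iterCentralBond (P := F.P K) (K - J)) (e p.1) (σ p.2)) p)) ∧
      Continuous jZ ∧ Continuous jV ∧ (∀ z, 0 ≤ jZ z) ∧ (∀ y, 0 ≤ jV y) ∧ 0 < jZ 0 ∧ 0 < jV 0 ∧
      (∀ᶠ y in 𝓝 (0 : EuclideanSpace ℝ (Fin dV)), 0 < jV y) ∧
      (∃ σ₀ : ℝ, 0 < σ₀ ∧ ∀ y, jV y = σ₀ * |LinearMap.det
        (jac (lie_adStable_pi (specialUnitaryLogChart (Fin 2)) {b : PBond (F.P K) 0 // b ∉ (combSet (K - J) : Set (PBond (F.P K) 0)) ∪ Set.range (iterCentralBond (P := F.P K) (K - J))}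
            (lie_adStable_specialUnitaryGroup (n := Fin 2))) (eV y) :
          (piLogChart (specialUnitaryLogChart (Fin 2)) {b : PBond (F.P K) 0 // b ∉ (combSet (K - J) : Set (PBond (F.P K) 0)) ∪ Set.range (iterCentralBond (P := F.P K) (K - J))}).lie →ₗ[ℝ]
          (piLogChart (specialUnitaryLogChart (Fin 2)) {b : PBond (F.P K) 0 // b ∉ (combSet (K - J) : Set (PBond (F.P K) 0)) ∪ Set.range (iterCentralBond (P := F.P K) (K - J))}).lie)|) ∧
      (fieldMeasure (F.P K) 0 (Matrix.specialUnitaryGroup (Fin 2) ℂ)).restrict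
          ((fun p : EuclideanSpace ℝ (Fin dZ) × EuclideanSpace ℝ (Fin dV) =>
        pivotAct F hJK (iterCentralBond (P := F.P K) (K - J)) (e p.1) (σ p.2)) '' (UZ ×ˢ UV)) =
        ((((volume : Measure (EuclideanSpace ℝ (Fin dZ))).prod (volume : Measure (EuclideanSpace ℝ (Fin dV)))).restrict (UZ ×ˢ UV)).withDensity
            fun w => ENNReal.ofReal (jZ w.1 * jV w.2)).map
          (fun p : EuclideanSpace ℝ (Fin dZ) × EuclideanSpace ℝ (Fin dV) =>
        pivotAct F hJK (iterCentralBond (P := F.P K) (K - J)) (e p.1) (σ p.2)) ∧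
      0 < ρ ∧ closedBall (0 : EuclideanSpace ℝ (Fin dZ)) ρ ⊆ UZ ∧
      0 < ∫ z in ball (0 : EuclideanSpace ℝ (Fin dZ)) ρ, jZ z := by
  classical
  obtain ⟨e, σ, eV, UZ, UV, jZ, jV, ρ₀, hec, he0, heres, hsurj, hσc, hσ0, hσs, hσF, hσT, hF4, hσgr, hUZo, hUVo, h0Z, h0V, hρ₀, hball, hinj,
      hopen, hF3, hjZc, hjVc, hjZ0, hjV0, hjZpos, hjVpos, hF4b, hchart⟩ :=
    exists_tubularHaarChart_act_local (F.P K) hk dZ dV hdZ hdV U₀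
  -- lift `e` into the subgroup (rooted ⇒ residual, px11's GAP 4)
  set el : EuclideanSpace ℝ (Fin dZ) → residualSubgroup F hJK × (PBond (F.P K) (K - J) → Matrix.specialUnitaryGroup (Fin 2) ℂ) :=
    fun z => (⟨(e z).1, residual_of_isResidual F hJK (heres z)⟩, (e z).2) with hel
  -- the action of record through the lift IS the letter's tube map (definitionally)
  have hΘ : (fun p : EuclideanSpace ℝ (Fin dZ) × EuclideanSpace ℝ (Fin dV) =>
      pivotAct F hJK (iterCentralBond (P := F.P K) (K - J)) (el p.1) (σ p.2)) =
      fun p => Function.extend (iterCentralBond (P := F.P K) (K - J)) (fun c => (e p.1).2 c * σ p.2 (iterCentralBond (P := F.P K) (K - J) c))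
        (GaugeField.gaugeAct (e p.1).1 (σ p.2)) := by
    funext p; rfl
  -- shrink the radius so that `jZ > jZ(0)/2` on the ball
  have hJat : ContinuousAt jZ (0 : EuclideanSpace ℝ (Fin dZ)) := hjZc.continuousAt
  obtain ⟨δ, hδ, hδJ⟩ := Metric.continuousAt_iff.1 hJat (jZ 0 / 2) (by linarith)
  set ρ : ℝ := min ρ₀ (δ / 2) with hρ
  have hρpos : 0 < ρ := lt_min hρ₀ (by linarith)
  have hρle : ρ ≤ ρ₀ := min_le_left _ _
  have hρδ : ρ < δ := lt_of_le_of_lt (min_le_right _ _) (by linarith)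
  have hballW : closedBall (0 : EuclideanSpace ℝ (Fin dZ)) ρ ⊆ UZ := (Metric.closedBall_subset_closedBall hρle).trans hball
  -- lower bound `jZ z ≥ jZ 0 / 2` on the ball
  have hlow : ∀ z ∈ ball (0 : EuclideanSpace ℝ (Fin dZ)) ρ, jZ 0 / 2 ≤ jZ z := by
    intro z hz
    have hd : dist z (0 : EuclideanSpace ℝ (Fin dZ)) < δ := lt_trans (mem_ball.1 hz) hρδ
    have := hδJ hd
    rw [Real.dist_eq] at this
    have := (abs_lt.1 this).1
    linarith
  refine ⟨el, σ, eV, UZ, UV, jZ, jV, ρ, ?_, ?_, ?_, hσc, hσ0, hσs, hσF, hσT, hF4, ?_, ?_, hUZo, hUVo, h0Z, h0V, ?_, ?_,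
    hjZc, hjVc, hjZ0, hjV0, hjZpos, hjVpos, ?_, hF4b, ?_, hρpos, hballW, ?_⟩
  · -- `el` continuous (w5's packaged row)
    exact (groupChart_rows_of_rooted F hJK hec he0 heres hsurj).1
  · -- `el 0 = 1`
    exact (groupChart_rows_of_rooted F hJK hec he0 heres hsurj).2.1
  · -- `𝓝 1 ≤ map el (𝓝 0)`: near `1`, residual = rooted (w5's packaged row)
    exact (groupChart_rows_of_rooted F hJK hec he0 heres hsurj).2.2
  · -- (T2) OFF-PIVOT QUADRATIC TRANSVERSALITY OF THE TUBE: rows (A0)(A1)(A2) of the letter, by §1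
    exact offPivot_transversal_of_rows F hJK hk hσF hσT hσgr
  · -- `𝓝 (σ 0) ≤ map Θ (𝓝 0)`
    rw [hΘ, hσ0]
    exact Filter.le_map fun s hs => hopen s hs
  · -- injectivity on the window
    rw [hΘ]; exact hinj
  · -- (F3) openness at every point of the window
    rw [hΘ]; exact hF3
  · -- `jV > 0` near `0`
    exact hjVc.continuousAt.eventually (Ioi_mem_nhds hjVpos)
  · -- the chart identity
    rw [hΘ]; exact hchart
  · -- `0 < ∫_{ball 0 ρ} jZ`
    have hcontJ : ContinuousOn jZ (closedBall (0 : EuclideanSpace ℝ (Fin dZ)) ρ) := hjZc.continuousOn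
    have hint : IntegrableOn jZ (ball (0 : EuclideanSpace ℝ (Fin dZ)) ρ) volume :=
      (hcontJ.integrableOn_compact (isCompact_closedBall _ _)).mono_set ball_subset_closedBall
    have hvol : 0 < (volume (ball (0 : EuclideanSpace ℝ (Fin dZ)) ρ)).toReal :=
      ENNReal.toReal_pos (measure_ball_pos volume _ hρpos).ne' measure_ball_lt_top.ne
    have hconst : ∫ z in ball (0 : EuclideanSpace ℝ (Fin dZ)) ρ, jZ 0 / 2 = (volume (ball (0 : EuclideanSpace ℝ (Fin dZ)) ρ)).toReal * (jZ 0 / 2) := by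
      rw [setIntegral_const, smul_eq_mul]; rfl
    calc (0 : ℝ) < (volume (ball (0 : EuclideanSpace ℝ (Fin dZ)) ρ)).toReal * (jZ 0 / 2) := mul_pos hvol (by linarith)
      _ = ∫ z in ball (0 : EuclideanSpace ℝ (Fin dZ)) ρ, jZ 0 / 2 := hconst.symm
      _ ≤ ∫ z in ball (0 : EuclideanSpace ℝ (Fin dZ)) ρ, jZ z :=
          setIntegral_mono_on (integrableOn_const measure_ball_lt_top.ne) hint measurableSet_ball fun z hz => hlow z hz

end Summit.QuantumFields.YangMills.Theorems.FluctuationComparisonRegPrIntLS2BetaTubularChartDockLocal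

end
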